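import Summits.BirchSwinnertonDyer.BirchSwinnertonDyer.Theses.GenusKolyvaginAtTwo

/-!
# Route `GenusKolyvaginAtTwo`, crux `KolyvaginExactAtTwo` (stmt-BirchSwinnertonDyer-22137): the
# level-one (`n = 1`, `M₀ = 0`) instance — `y_K ∉ 2E(K[1])` ⟹ `Ш(E/K)[2^∞] = 0` (glue, PROVED)

Helper for crux #3 `KolyvaginExactAtTwo` (registered skeleton `Lines/birth`: `stub_upperBoundAtTwo`,
`stub_lowerBoundAtTwo` → `KolyvaginExactAtTwo_of`, seat `bsd-line-gk2-p3`). The crux quantifies over a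
square-free level `n` of Kolyvagin primes at `2` and a level-`n` datum `d` with `P(n) ∉ 2E(K[n])`.
Its FIRST instance is `n = 1`, `d = d₁` (`1` is square-free with no prime factors, `P(1) = y_K`):
the certificate is then `y_K ∉ 2E(K[1])`, which forces `M₀ = 0` (`2^0 ∣ y_K`, `2^1 ∤ y_K`), and the
crux returns `#Ш(E_K/K)[2^∞] = 2^0 = 1`, i.e. `Ш(E_K/K)[2^∞] = 0` — Kolyvagin's original
"`p ∤ [E(K) : ℤy_K] ⟹ Ш(E/K)[p^∞] = 0`" at `p = 2` under the Theorem-B₂ exclusions. This is the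
form in which the route's crux #6 `MinimalTwinBSDTwo` foresees consuming exactness ("at `M₀ = 0` for
the twin's own Heegner field", route header) and the cheapest falsifier row of the route (X5 WALL
row 1: a `2`-primitive `y_K` on a habitat curve would contradict `16 ∣ #Ш_an`). Both theorems here
take the crux — a registered route obligation — as an explicit hypothesis `hX`; nothing is claimed
unconditionally and no named fact enters. BSD is not proved by any of this.

* `card_sha_two_eq_one_of_kolyvaginExactAtTwo` — `hX` + the crux's standing hypotheses + `y_K ∉ 2E(K[1])`
  ⟹ `#Ш(E_K/K)[2^∞] = 1`;
* `sha_two_torsion_eq_zero_of_kolyvaginExactAtTwo` — hence every `2`-power-torsion class of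
  `Ш(E_K/K)` is `0`.

References: [McCallumLMS1991] §1 Theorem (Kolyvagin), §5 Lemma 5.1; [GrossLMS1991] §4 (4.1)
(`P_1 = y_K`); [Kolyvagin1989Izv] Thm. B_l (l = 2).
-/

-- D-0017: single-problem summit, so `Summit.BirchSwinnertonDyer.BirchSwinnertonDyer.…` repeats a
-- namespace BY DESIGN.
set_option linter.dupNamespace false

noncomputable section

namespace Summit.BirchSwinnertonDyer.BirchSwinnertonDyer.Theorems

open Literature.NumberTheory.EllipticCurves Literature.NumberTheory.EllipticCurves.ModularForms
open Summit.BirchSwinnertonDyer.BirchSwinnertonDyer.Theses.GenusKolyvaginAtTwo (KolyvaginExactAtTwo)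

/-- **Level one of `KolyvaginExactAtTwo`: a `2`-primitive `y_K` kills `Ш(E/K)[2^∞]`.** Granted the
crux `KolyvaginExactAtTwo` (`hX`): for `W/ℚ` globally minimal non-CM with `ρ_{E,2^n}` onto for all
`n ≥ 1`, `K` imaginary quadratic with odd `d_K ≠ -3`, the Heegner hypothesis and the two (H2)
non-square conditions, a parametrisation datum `Dt`, orientation `β`, embedding `ι` and conductor-`1`
datum `d₁` with `y_K = d₁.derivedPoint` of infinite order and NOT `2`-divisible in `E(K[1])`:
`#Ш(E_K/K)[2^∞] = 1`. (Instance `M₀ = 0`, `n = 1`, `d = d₁` of the crux: `2^0 • y_K = y_K`,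
`Squarefree 1`, `Nat.primeFactors 1 = ∅`.) [cite: McCallumLMS1991, §1 Theorem (Kolyvagin), §5 Lemma 5.1] -/
theorem card_sha_two_eq_one_of_kolyvaginExactAtTwo (hX : KolyvaginExactAtTwo)
    (W : WeierstrassCurve ℚ) [W.IsElliptic] [W.IsGloballyMinimal] [NeZero (W.conductorNorm ℤ)]
    (hcm : ¬ W.HasCM) (K : Type) [Field K] [NumberField K] (hK : IsImaginaryQuadratic K)
    (hodd : Odd (NumberField.discr K)) (h3 : NumberField.discr K ≠ -3)
    (hH : SatisfiesHeegnerHypothesis (W.conductorNorm ℤ) K)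
    (hΔ₁ : ¬ IsSquare ((NumberField.discr K : ℚ) * -|W.Δ|))
    (hΔ₂ : ¬ IsSquare ((NumberField.discr K : ℚ) * (-(2 * |W.Δ|))))
    (hρ : ∀ n : ℕ, 0 < n → W.HasSurjectiveModNGaloisRep ((2 : ℤ) ^ n))
    (Dt : ModularParametrizationData W (W.conductorNorm ℤ)) (β : ℤ) (ι : K →+* ℂ)
    (d₁ : KolyvaginHeegnerData Dt β ι 1) (hy : ¬ IsOfFinAddOrder d₁.derivedPoint)
    (h2 : ¬ ∃ Q : (W.baseChange (ringClassField K ι 1)).toAffine.Point, (2 : ℤ) • Q = d₁.derivedPoint) :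
    Nat.card (AddCommGroup.primaryComponent (W.baseChange K).sha 2) = 1 := by
  have hdiv : ∃ Q : (W.baseChange (ringClassField K ι 1)).toAffine.Point,
      ((2 ^ 0 : ℕ) : ℤ) • Q = d₁.derivedPoint :=
    ⟨d₁.derivedPoint, by rw [pow_zero, Nat.cast_one, one_smul]⟩
  have hndiv : ¬ ∃ Q : (W.baseChange (ringClassField K ι 1)).toAffine.Point,
      ((2 ^ (0 + 1) : ℕ) : ℤ) • Q = d₁.derivedPoint := by
    rwa [zero_add, pow_one, Nat.cast_ofNat]
  have hKoly : ∀ ℓ ∈ (1 : ℕ).primeFactors,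
      Zhang2014.IsKolyvaginPrime (W.conductorNorm ℤ) W K 2 ℓ := by
    intro ℓ hℓ
    rw [Nat.primeFactors_one] at hℓ
    exact absurd hℓ (Finset.notMem_empty ℓ)
  have h := hX W hcm K hK hodd h3 hH hΔ₁ hΔ₂ hρ Dt β ι d₁ hy 0 hdiv hndiv 1 d₁ squarefree_one hKoly h2
  rw [h, mul_zero, pow_zero]

/-- **… hence `Ш(E_K/K)` has no non-zero `2`-power torsion.** Under the same hypotheses, every class
`x ∈ Ш(E_K/K)` with `2^k • x = 0` is `0` (the `2`-primary component has one element).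
[cite: McCallumLMS1991, §1 Theorem (Kolyvagin)] -/
theorem sha_two_torsion_eq_zero_of_kolyvaginExactAtTwo (hX : KolyvaginExactAtTwo)
    (W : WeierstrassCurve ℚ) [W.IsElliptic] [W.IsGloballyMinimal] [NeZero (W.conductorNorm ℤ)]
    (hcm : ¬ W.HasCM) (K : Type) [Field K] [NumberField K] (hK : IsImaginaryQuadratic K)
    (hodd : Odd (NumberField.discr K)) (h3 : NumberField.discr K ≠ -3)
    (hH : SatisfiesHeegnerHypothesis (W.conductorNorm ℤ) K)
    (hΔ₁ : ¬ IsSquare ((NumberField.discr K : ℚ) * -|W.Δ|))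
    (hΔ₂ : ¬ IsSquare ((NumberField.discr K : ℚ) * (-(2 * |W.Δ|))))
    (hρ : ∀ n : ℕ, 0 < n → W.HasSurjectiveModNGaloisRep ((2 : ℤ) ^ n))
    (Dt : ModularParametrizationData W (W.conductorNorm ℤ)) (β : ℤ) (ι : K →+* ℂ)
    (d₁ : KolyvaginHeegnerData Dt β ι 1) (hy : ¬ IsOfFinAddOrder d₁.derivedPoint)
    (h2 : ¬ ∃ Q : (W.baseChange (ringClassField K ι 1)).toAffine.Point, (2 : ℤ) • Q = d₁.derivedPoint)
    (x : (W.baseChange K).sha) (k : ℕ) (hx : 2 ^ k • x = 0) : x = 0 := by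
  have hcard := card_sha_two_eq_one_of_kolyvaginExactAtTwo hX W hcm K hK hodd h3 hH hΔ₁ hΔ₂ hρ Dt β ι
    d₁ hy h2
  haveI : Finite (AddCommGroup.primaryComponent (W.baseChange K).sha 2) :=
    Nat.finite_of_card_ne_zero (by rw [hcard]; exact one_ne_zero)
  have hsub : Subsingleton (AddCommGroup.primaryComponent (W.baseChange K).sha 2) :=
    (Nat.card_eq_one_iff_unique.mp hcard).1
  have hmem : x ∈ AddCommGroup.primaryComponent (W.baseChange K).sha 2 :=
    (AddCommGroup.mem_primaryComponent).2 ⟨k, hx⟩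
  have h0 : (0 : (W.baseChange K).sha) ∈ AddCommGroup.primaryComponent (W.baseChange K).sha 2 :=
    zero_mem _
  exact congrArg Subtype.val (hsub.elim ⟨x, hmem⟩ ⟨0, h0⟩)

end Summit.BirchSwinnertonDyer.BirchSwinnertonDyer.Theorems

end
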